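import Literature.Barriers.RiemannHypothesis.LiouvilleSignConjectures
import Literature.NumberTheory.LFunctions.TuranLiouvilleCriterionSqrt
import HarnessLib

/-!
# Turán's 1948 criterion holds — discharge of `Turan1948_criterionT` (proofs for `LiouvilleSignConjectures.lean`)

Sibling of `Literature/Barriers/RiemannHypothesis/LiouvilleSignConjectures.lean`, which vendors
**Turán's criterion** as the named Prop
`Literature.Barriers.RiemannHypothesis.Turan1948_criterionT`:

  `(∃ c > 0, ∃ N, ∀ n ≥ N, −c/√n < T(n)) → RiemannHypothesis`,   `T(x) = ∑_{n ≤ x} λ(n)/n`,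

as printed in Mossinghoff–Trudgian 2012, §1 (p. 158): "Turán showed that if there exists a positive
constant `c` such that `T(n) > −c/√n` for all sufficiently large `n`, then the Riemann hypothesis
would follow." This file proves it (`Turan1948_criterionT_holds`), from the tree's
`Literature.NumberTheory.LFunctions.Turan1948.riemannHypothesis_of_liouvilleHarmonicSum_nat_lower`
(`Literature/NumberTheory/LFunctions/TuranLiouvilleCriterionSqrt.lean`), which formalises the
printed proof — Mossinghoff–Trudgian's Theorem 2.4 with `α = 1`: the Mellin transform
`∫_1^∞ (T(x) + 2c x^{-1/2}) x^{-(s+1)} dx = ζ(2s+2)/(s ζ(s+1)) + 2c/(s + 1/2)` (`σ > 1`; partial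
summation on `ζ(2s)/ζ(s) = ∑ λ(n) n^{-s}`, Titchmarsh (1.2.11)) has an eventually non-negative
integrand, so by Landau's theorem (Montgomery–Vaughan Lemma 15.1, the tree's
`Literature.NumberTheory.LFunctions.Landau.integrableOn_of_differentiableOn_union_convex`) it
converges up to the first real singularity of the right-hand side; `ζ` has no zeros on `(1/2, ∞)`
(`ζ(σ) < 0` on `(0, 1)`, Titchmarsh §2.12), so the transform is holomorphic on `σ > −1/2`, whence
`ζ(s + 1) ≠ 0` for `σ > −1/2`, `s ≠ 0`, i.e. the Riemann hypothesis (via the symmetry of the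
non-trivial zeros, the tree's `quasiRiemannHypothesis_one_half_iff_holds`). The passage from
integers `n` to real `x` uses `T(x) = T(⌊x⌋)` and `√⌊x⌋ ≥ √x/2` (`x ≥ 1`). (The special case
`c = 0`, "`T(n) ≥ 0` eventually ⟹ RH", Titchmarsh §14.38, is the tree's
`Literature.NumberTheory.LFunctions.riemannHypothesis_of_eventually_nonneg_liouvilleHarmonicSum`,
`TuranLiouvilleCriterion.lean`, whose partial summation and zero-free strip the `1/√x` version
reuses.)

The other sibling `LiouvilleSignConjecturesProofs.lean` (certified computations refuting Pólya's
conjecture) is deliberately not imported: this file is computation-free (axioms `propext`,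
`Classical.choice`, `Quot.sound` only).

Consequence recorded here: with `Turan1948_criterionT_holds`, Titchmarsh's remark that (14.38.1)
"implies the Riemann hypothesis" is a theorem of the tree
(`riemannHypothesis_of_turanHypothesis1438`, `riemannHypothesis_of_turanConjecture`) — vacuous in
fact, both hypotheses being false (`LiouvilleSignConjectures`), but proved without using their
falsity.

## References

* [MossinghoffTrudgian2012] M. J. Mossinghoff, T. S. Trudgian, *Between the problems of Pólya and
  Turán*, J. Aust. Math. Soc. 93 (2012), 157–171 — §1 (p. 158); Lemma 2.3, Theorem 2.4 (p. 162)
  (read).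
* [Titchmarsh1986] E. C. Titchmarsh, *The Theory of the Riemann Zeta-Function*, 2nd ed. —
  (1.2.11) (p. 6), §2.12, §14.38 (p. 283) (read).
* [MontgomeryVaughan2007] H. L. Montgomery, R. C. Vaughan, *Multiplicative Number Theory I*,
  §15.1 Lemma 15.1 (through `LandauOscillation.lean`).
-/

noncomputable section

namespace Literature.Barriers.RiemannHypothesis

/-- **Turán's 1948 criterion holds** (discharge of the named fact `Turan1948_criterionT`): if
there is `c > 0` with `T(n) > −c/√n` for all sufficiently large integers `n`, then the Riemann
hypothesis follows. From the tree's
`Literature.NumberTheory.LFunctions.Turan1948.riemannHypothesis_of_liouvilleHarmonicSum_nat_lower`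
(Mossinghoff–Trudgian's Theorem 2.4 with `α = 1`, proved there by Landau's theorem).
[cite: MossinghoffTrudgian2012, §1 (p. 158) and Theorem 2.4] [cite: Titchmarsh1986, §14.38] -/
theorem Turan1948_criterionT_holds : Turan1948_criterionT := by
  rintro ⟨c, hc, N, hN⟩
  exact Literature.NumberTheory.LFunctions.Turan1948.riemannHypothesis_of_liouvilleHarmonicSum_nat_lower
    hc.le fun n hn ↦ (hN n hn).le

/-- Hence Titchmarsh's (14.38.1) (`T(x) ≥ 0` for all `x > 0`) implies the Riemann hypothesis, as
stated in Titchmarsh §14.38 ("which in turn implies the Riemann hypothesis") — unconditionally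
proved (and vacuous, (14.38.1) being false: `not_turanConjecture_of_BFM`).
[cite: Titchmarsh1986, §14.38] -/
theorem riemannHypothesis_of_turanHypothesis1438 (h : TuranHypothesis1438) : RiemannHypothesis :=
  Turan1948_criterionT_holds h.criterion_hypothesis

/-- … and so does Turán's conjecture `T(n) > 0` (`n ≥ 1`).
[cite: MossinghoffTrudgian2012, §1 (p. 158)] -/
theorem riemannHypothesis_of_turanConjecture
    (h : ∀ n : ℕ, 1 ≤ n → 0 < Literature.NumberTheory.LFunctions.liouvilleHarmonicSum n) :
    RiemannHypothesis :=
  Turan1948_criterionT_holds ⟨1, one_pos, 1, fun n hn ↦ by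
    have h0 : 0 < Literature.NumberTheory.LFunctions.liouvilleHarmonicSum n := h n hn
    have h1 : 0 < 1 / Real.sqrt n := by
      have : 0 < Real.sqrt n := Real.sqrt_pos.2 (by exact_mod_cast hn)
      positivity
    linarith⟩

end Literature.Barriers.RiemannHypothesis
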